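import Summits.CriticalPhenomena.PercolationContinuityZ3.Theorems.FK.NonzeroFieldGibbsUniqueness
import HarnessLib

/-!
# THE UNIQUENESS PHASE DIAGRAM OF THE ISING MODEL ON `ℤ^d`, `d ≥ 2`: `|𝒢(β,h)| = 1 ⟺ (h ≠ 0 ∨ β ≤ β_c(d))`, AND
# `|𝒢(β,h)| = 1 ⟺ ψ(β,·) IS DIFFERENTIABLE AT h` (Friedli–Velenik 2017, Thm. 3.25 (1)–(3) complete and Thm. 3.34, in DLR form)

Claimed R42 (8)(c) in the cell INBOX at 2026-08-29T01:14:38Z by fkp-10a gen 357 (NEW CLAIM #2 of the gen), addressed to coordinator fk-4 gen 288 (seated 01:00Z 2026-08-29 by l.8634; R160 = row FO-10a-g357); lineage row FO-10a-g357f (self-suggested), package g357-field, label HF-F.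
Helper file of the `fk-continuity` build cell (bschramm lane; `--supports stmt-CriticalPhenomena-4575`); builds on
p205010 (kernel theorem, internal audit signed; external expert review pending). No definitions, no named facts, no
sorries; standard axioms. UNCONDITIONAL (nearest-neighbour Ising model on `ℤ^d`; `β > 0`; `d ≥ 2` where `β_c` enters).

Assembly of the tree's phase-diagram theorems in the language of `HasUniqueGibbsMeasure (isingSpecification (zdGraph d) β h)`:
uniqueness at every `h ≠ 0` and at every `h` where `ψ(β,·)` is differentiable (`NonzeroFieldGibbsUniqueness`), `m*(β) = 0`
for `β ≤ β_c` (Aizenman–Duminil-Copin–Sidoravicius at `β_c`), `m*(β) > 0` for `β > β_c` (Peierls), the states `μ^± ∈ 𝒢(β,h)`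
with one-point functions `± m*` at `h = 0`:

* **`not_hasUniqueGibbsMeasure_of_criticalBeta_lt`** — for `d ≥ 2` and `β > β_c(d)`, `𝒢(β,0)` is NOT a singleton
  (`μ⁺ ≠ μ⁻`: `⟨σ_0⟩^± = ± m*(β)`, `m*(β) > 0`) — Friedli–Velenik Thm. 3.25 (3) in DLR form;
* **`hasUniqueGibbsMeasure_zero_field_iff`** — for `d ≥ 2`, `β > 0`: `|𝒢(β,0)| = 1 ⟺ β ≤ β_c(d)` (Thm. 3.25 (2)–(3) with the
  continuity of the transition, `m*(β_c) = 0`);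
* **`hasUniqueGibbsMeasure_iff`** — **THE PHASE DIAGRAM: for `d ≥ 2`, `β > 0` and every real `h`,
  `HasUniqueGibbsMeasure (isingSpecification (zdGraph d) β h) ↔ (h ≠ 0 ∨ β ≤ β_c(d))`** — the coexistence region of the
  nearest-neighbour Ising model is exactly the half-line `{h = 0, β > β_c}`;
* **`hasUniqueGibbsMeasure_iff_differentiableAt_pressure`** — **Friedli–Velenik Thm. 3.34 as an equivalence at every
  field**: for `d ≥ 1`, `β > 0`, `h ∈ ℝ`, `|𝒢(β,h)| = 1 ⟺ ψ(β,·)` is differentiable at `h` (⇐ is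
  `hasUniqueGibbsMeasure_of_differentiableAt_pressure`; ⇒: at `h ≠ 0` the pressure is differentiable anyway, at `h = 0`
  uniqueness forces `⟨σ_0⟩⁺ = ⟨σ_0⟩⁻ = −⟨σ_0⟩⁺`, i.e. `m*(β) = 0`, i.e. differentiability by `differentiableAt_pressure_zero_iff`);
* `spontaneousMagnetization_eq_zero_of_hasUniqueGibbsMeasure` — uniqueness at `(β,0)` ⇒ `m*(β) = 0` (the converse of the
  tree's `hasUniqueGibbsMeasure_of_plusExpect_spinAt_eq_zero_holds`, Lebowitz–Martin-Löf).

## References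

* S. Friedli, Y. Velenik, *Statistical Mechanics of Lattice Systems*, CUP (2017), Thm. 3.25, Thm. 3.28, Thm. 3.34,
  Prop. 3.29. [FriedliVelenik2017]
* J. L. Lebowitz, A. Martin-Löf, Comm. Math. Phys. 25 (1972) 276–282. [LebowitzMartinlof1972]
* M. Aizenman, H. Duminil-Copin, V. Sidoravicius, Comm. Math. Phys. 334 (2015) 719–742, Thm. 1.2. [AizenmanDuminilCopinSidoraviciusCMP2015]
* H.-O. Georgii, *Gibbs Measures and Phase Transitions*, 2nd ed., de Gruyter (2011), §6.2, Ch. 8. [Georgii2011]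
-/

noncomputable section

namespace Summit.CriticalPhenomena.PercolationContinuityZ3.Theorems.FK

namespace IsingSusceptibility

open MeasureTheory Filter Topology Finset Set
open Literature.Probability.LatticeModels

variable {d : ℕ}

/-! ### Uniqueness at `h = 0` forces `m*(β) = 0` -/

/-- **If `𝒢(β,0)` is a singleton then `m*(β) = 0`** (`β ≥ 0`): `μ⁺ = μ⁻` gives `⟨σ_0⟩⁺_{β,0} = ⟨σ_0⟩⁻_{β,0} = −⟨σ_0⟩⁺_{β,0}`.
(Converse of Lebowitz–Martin-Löf / Friedli–Velenik Thm. 3.28, 1 ⇒ 3.) [cite: FriedliVelenik2017, Thm. 3.28; LebowitzMartinlof1972, Theorem] -/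
theorem spontaneousMagnetization_eq_zero_of_hasUniqueGibbsMeasure {β : ℝ} (hβ : 0 ≤ β)
    (hU : HasUniqueGibbsMeasure (isingSpecification (zdGraph d) β 0)) : spontaneousMagnetization d β = 0 := by
  obtain ⟨μp, hμp, -, hp⟩ := exists_plusMeasure_holds (d := d) (β := β) (h := 0) hβ
  obtain ⟨μm, hμm, -, hm⟩ := exists_minusMeasure_holds (d := d) (β := β) (h := 0) hβ
  have hμ : μp = μm := hU.1 hμp hμm
  have h1 : plusCorr d β 0 {0} = minusCorr d β 0 {0} := by rw [← hp {0}, ← hm {0}, hμ]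
  rw [minusCorr_eq_plusCorr_neg hβ 0 {0}, neg_zero, Finset.card_singleton, pow_one] at h1
  rw [spontaneousMagnetization_eq_plusCorr]
  linarith

/-- **FRIEDLI–VELENIK THM. 3.25 (3) IN DLR FORM: for `d ≥ 2` and `β > β_c(d)`, the zero-field Ising model has MORE THAN
ONE infinite-volume Gibbs measure** (`μ⁺ ≠ μ⁻` since `m*(β) > 0` by Peierls, tree theorem
`spontaneousMagnetization_pos_of_criticalBeta_lt_holds`). [cite: FriedliVelenik2017, Thm. 3.25 (3); Georgii2011, §6.2] -/
theorem not_hasUniqueGibbsMeasure_of_criticalBeta_lt (hd : 2 ≤ d) {β : ℝ} (hβc : criticalBeta d < β) :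
    ¬ HasUniqueGibbsMeasure (isingSpecification (zdGraph d) β 0) := fun hU =>
  (spontaneousMagnetization_pos_of_criticalBeta_lt_holds hd hβc).ne'
    (spontaneousMagnetization_eq_zero_of_hasUniqueGibbsMeasure ((criticalBeta_nonneg d).trans hβc.le) hU)

/-- **The zero-field line: for `d ≥ 2` and `β > 0`, `|𝒢(β,0)| = 1 ⟺ β ≤ β_c(d)`** (uniqueness up to AND INCLUDING `β_c`
by `m*(β_c) = 0`, Aizenman–Duminil-Copin–Sidoravicius; non-uniqueness above). [cite: FriedliVelenik2017, Thm. 3.25 (2)–(3); AizenmanDuminilCopinSidoraviciusCMP2015, Thm. 1.2] -/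
theorem hasUniqueGibbsMeasure_zero_field_iff (hd : 2 ≤ d) {β : ℝ} (hβ : 0 < β) :
    HasUniqueGibbsMeasure (isingSpecification (zdGraph d) β 0) ↔ β ≤ criticalBeta d := by
  refine ⟨fun hU => ?_, fun hβc => hasUniqueGibbsMeasure_of_le_criticalBeta' hd hβ hβc⟩
  by_contra hlt
  exact not_hasUniqueGibbsMeasure_of_criticalBeta_lt hd (not_le.1 hlt) hU

/-! ### THE PHASE DIAGRAM -/

/-- **THE UNIQUENESS PHASE DIAGRAM OF THE NEAREST-NEIGHBOUR ISING MODEL ON `ℤ^d` (`d ≥ 2`, `β > 0`)**: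
`HasUniqueGibbsMeasure (isingSpecification (zdGraph d) β h) ↔ (h ≠ 0 ∨ β ≤ β_c(d))` — there is a unique infinite-volume
Gibbs measure everywhere except on the half-line `{h = 0, β > β_c(d)}`, where `μ⁺ ≠ μ⁻` coexist (Friedli–Velenik
Thm. 3.25 (1)–(3) complete, with the continuity of the transition at `β_c`).
[cite: FriedliVelenik2017, Thm. 3.25; AizenmanDuminilCopinSidoraviciusCMP2015, Thm. 1.2] -/
theorem hasUniqueGibbsMeasure_iff (hd : 2 ≤ d) {β : ℝ} (hβ : 0 < β) (h : ℝ) :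
    HasUniqueGibbsMeasure (isingSpecification (zdGraph d) β h) ↔ (h ≠ 0 ∨ β ≤ criticalBeta d) := by
  by_cases hh : h = 0
  · subst hh
    rw [hasUniqueGibbsMeasure_zero_field_iff hd hβ]
    simp
  · simp only [ne_eq, hh, not_false_eq_true, true_or, iff_true]
    exact hasUniqueGibbsMeasure_of_field_ne_zero (by omega) hβ hh

/-- **Phase coexistence happens exactly on `{h = 0, β > β_c}`** (`d ≥ 2`, `β > 0`): the negation of the phase diagram.
[cite: FriedliVelenik2017, Thm. 3.25] -/
theorem not_hasUniqueGibbsMeasure_iff (hd : 2 ≤ d) {β : ℝ} (hβ : 0 < β) (h : ℝ) :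
    ¬ HasUniqueGibbsMeasure (isingSpecification (zdGraph d) β h) ↔ (h = 0 ∧ criticalBeta d < β) := by
  rw [hasUniqueGibbsMeasure_iff hd hβ h, not_or, not_not, not_le]

/-! ### Uniqueness ⟺ differentiability of the pressure in the field (Friedli–Velenik Thm. 3.34) -/

/-- **FRIEDLI–VELENIK THM. 3.34 AS AN EQUIVALENCE, AT EVERY FIELD**: for `d ≥ 1`, `β > 0` and `h ∈ ℝ`,
`|𝒢(β,h)| = 1 ⟺ ψ(β,·)` is differentiable at `h`. (⇐: `hasUniqueGibbsMeasure_of_differentiableAt_pressure`. ⇒: at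
`h ≠ 0` the pressure is differentiable (`hasDerivAt_pressure_field`, GHS); at `h = 0` uniqueness forces `m*(β) = 0`, which
is differentiability at `0`, `differentiableAt_pressure_zero_iff`.) [cite: FriedliVelenik2017, Thm. 3.34 and Prop. 3.29] -/
theorem hasUniqueGibbsMeasure_iff_differentiableAt_pressure (hd : 1 ≤ d) {β : ℝ} (hβ : 0 < β) (h : ℝ) :
    HasUniqueGibbsMeasure (isingSpecification (zdGraph d) β h) ↔ DifferentiableAt ℝ (fun t => pressure d β t) h := by
  refine ⟨fun hU => ?_, hasUniqueGibbsMeasure_of_differentiableAt_pressure hβ⟩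
  rcases lt_trichotomy h 0 with hneg | rfl | hpos
  · exact (hasDerivAt_pressure_field_of_neg hd hβ.le hneg).differentiableAt
  · exact (differentiableAt_pressure_zero_iff hd hβ).2 (spontaneousMagnetization_eq_zero_of_hasUniqueGibbsMeasure hβ.le hU)
  · exact (hasDerivAt_pressure_field hd hβ.le hpos).differentiableAt

/-- **The kinks of `h ↦ ψ(β,h)` are exactly the points of phase coexistence**: for `d ≥ 1`, `β > 0`, `h ∈ ℝ`,
`¬ DifferentiableAt ψ(β,·) h ↔ ¬ HasUniqueGibbsMeasure (β,h)`; with `hasUniqueGibbsMeasure_iff` (`d ≥ 2`): the only kink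
of `ψ(β,·)` is at `h = 0`, and it is there iff `β > β_c(d)`. [cite: FriedliVelenik2017, Thm. 3.34 and Thm. 3.25] -/
theorem not_differentiableAt_pressure_iff (hd : 2 ≤ d) {β : ℝ} (hβ : 0 < β) (h : ℝ) :
    ¬ DifferentiableAt ℝ (fun t => pressure d β t) h ↔ (h = 0 ∧ criticalBeta d < β) := by
  rw [← hasUniqueGibbsMeasure_iff_differentiableAt_pressure (by omega) hβ h, not_hasUniqueGibbsMeasure_iff hd hβ h]

end IsingSusceptibility

end Summit.CriticalPhenomena.PercolationContinuityZ3.Theorems.FK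

end
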